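import Literature.IUT.LogVolume.Corollary22PartIIPointwise
import Literature.IUT.LogVolume.Corollary22FullGaloisImage
import Literature.IUT.LogVolume.Corollary22PartIAll
import Literature.NumberTheory.DiophantineGeometry.GenEllNorthcottProofs
import HarnessLib

/-!
# Joshi, *Arithmetic Teichmüller Spaces IV: Proof of the abc-conjecture* (arXiv:2403.10430v2) §5.8,
# «Proof of the Existence Theorem (Theorem 5.7.1)», II: the lemmas on the Legendre curves `C_λ` — Lemma 5.8.7 at the
# point, Lemmas 5.8.8, 5.8.9, 5.8.11 and the «Completion» up to (P6) — TYPED over the tree's `λ`-line vocabulary and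
# DISCHARGED from the tree's [IUTchIV] Cor. 2.2 (ii) proof files

Object/record file of the abc-iut cell, branch E «type Joshi's construction, test vs S» (rung LADDER-ABC:A2.E; seat
abc-iut-E-t29, slot T-29; JOSHI-DAG nodes J4:Lem5.8.8, J4:Lem5.8.9, J4:Lem5.8.11 (+ J4:Lem5.8.7 at the point); companion of
`Joshi/ATS4ExistenceLemmas.lean` (J4:Lem5.8.1, 5.8.2, 5.8.7 over the abstract `TateDatum`)). **No side is taken** on
[IUTchIII] Cor. 3.12 / [IUTchIV] Thm. 1.10, on Joshi's claims (unrefereed arXiv preprint, «Preliminary version for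
comments») or on Mochizuki's report on them; typed ≠ proved ≠ endorsed. Locators «p.N l.M» = line M of page file
`pNNNN.txt` of the cell's render `HOME/lit/renders/Joshi-arxiv-2403.10430/` (v2). Nothing of the disputed chain occurs in
§5.8: Lemmas 5.8.8/5.8.9/5.8.11 are the CLASSICAL steps (P4) ([GenEll] Lem. 3.5), the (P5)-exclusion and (P6) ([GenEll]
Lem. 3.1 (iii) / Thm. 3.8) of the printed proof of [IUTchIV] Cor. 2.2 (ii), pp. 45–46, every one of which the tree PROVES
(`Literature.IUT.LogVolume.Corollary22FullGaloisImage`, `…Corollary22PartIIPointwise`, `…Corollary22PartIAll`,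
`GenEll.northcott_UPle_holds`). Each item is typed AS PRINTED as a `Prop` carrying Joshi's claim tag and DISCHARGED by name
(E-PLAN R6); no new `Prop` fact, no axiom, no sorry. Object file (E-PLAN R14): imports Literature only.

CARRIERS = the tree's [GenEll] §1 vocabulary of the `λ`-line, exactly as the tree types [IUTchIV] Cor. 2.2: «Z = Z(Z, S) ⊂
M_ell(Q̄) compactly bounded, {2, ∞} ⊆ S, (5.6.2)» (Prop. 5.6.1 / Thm. 5.7.1, p.53) ↦ `D : GenEll.CBData` with
`Cor22.Hypotheses D`; «C_λ ∈ Z ∩ U(Q̄)_{≤d}» (p.53 l.39) ↦ `P ∈ D.toSet ∩ GenEll.UPle d` (the point `λ` presented over its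
minimal field `L_tpd = ℚ(λ)`); «Q = Tate(C_λ/L)» ↦ `Cor22.logQForall P` (a normalised Arakelov degree, invariant under
`L/L_tpd` — Joshi's Prop. 4.4.4, slot T-26); «L = L_mod(√−1, C_λ[2·3·5])» (p.53 l.40; `L_mod(C_λ[2]) = L_tpd`) ↦ a
theta-field `Cor22.IsThetaField P L`, the curve `C_λ/L` ↦ `Cor22.thetaEllPoint P hU L`; «δ = 2^12·3^3·5·d» ↦
`Cor22.delta d`; «primes of multiplicative reduction of C_λ» ↦ `Cor22.badPlaces P` (poles of `j(λ)` over `L_tpd`: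
potentially multiplicative = multiplicative over `L`, `C_λ/L` being semistable, `IsThetaField.isSemistable`); «finitely
many elliptic curves» ↦ `GenEll.HasFinitelyManyPoints` (counted through minimal polynomials, as the tree's `Exc_d`).

DISCREPANCY LOCATED (typed side by side, for the faithfulness lane ref-x; located, not adjudicated): (D3) Lem. 5.8.9
prints the set «{v ∈ V_{L_mod} : v ∤ (2ℓ)}» (every multiplicative prime PRIME TO `2ℓ`); the proof's first step (5.8.10)
«Tate_2(C_λ) ≤ Q^{1/2}·log ℓ» and the «Completion» (p.57 l.21 «by Lemma 5.8.9, C_λ has at least one prime of multiplicative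
reduction») use the complement, i.e. [IUTchIV] p.46 (P5) «𝕍^bad_mod = ∅ ⟹ h bounded»; `Lem589` (intended) is PROVED,
`Lem589AsPrinted` is typed only (no claim made about its truth).
-/

noncomputable section

open Real Finset NumberField IsDedekindDomain
open Literature.IUT.LogVolume Literature.IUT.LogVolume.Cor22
open Literature.NumberTheory.DiophantineGeometry.GenEll

namespace Summit.ABC.IUTFork.Joshi.ATS4

/-! ## The geometric lemmas on the `λ`-line: `Z ↦ D : CBData` (hypotheses of Prop. 5.6.1 / Thm. 5.7.1 ↦ `Cor22.Hypotheses D`),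
`C_λ ∈ Z ∩ U(Q̄)_{≤d} ↦ P ∈ D.toSet ∩ UPle d`, `Q = Tate(C_λ) ↦ logQForall P` -/

/-- **«Let ℓ be a prime given by Lemma 5.8.7»** (p.56 l.44; p.57 l.20) for the curve `C_λ`, `λ = P ∈ U(Q̄)_{≤d}`: a prime
with (1) `Q^{1/2} ≤ ℓ ≤ 10·δ·Q^{1/2}·log(2·δ·Q)` (`Q = logQForall P`, `δ = delta d`), (2) `ℓ ∤ a_v` for the nonzero `a_v`
(over `L_tpd`: `Cor22.CondP2`; for `ℓ ≥ 7` equivalent to the condition over `L`, whose ramification indices divide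
`2^10·3^2·5`), (3) `a_v < Q^{1/2}` at the places of residue characteristic `ℓ`. = the tree's (P1)–(P3) at the point.
[claim: Joshi2024ATS4, status: disputed] -/
def IsLem587Prime (d : ℕ) (P : NFPoint) (ℓ : ℕ) : Prop :=
  ℓ.Prime ∧ Real.sqrt (logQForall P) ≤ ℓ ∧
    (ℓ : ℝ) ≤ 10 * delta d * Real.sqrt (logQForall P) * Real.log (2 * delta d * logQForall P) ∧
    CondP2 P ℓ ∧ ∀ v ∈ badPlaces P, residueChar P.F v = ℓ → localHeight P v < Real.sqrt (logQForall P)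

/-- **Lemma 5.8.7 at the point `λ` HOLDS** under «Q^{1/2} ≥ ξ_prm» (tree: `Cor22.exists_prime_P1_P2_P3_point`).
DISCHARGED. [claim: Joshi2024ATS4, status: disputed] -/
theorem exists_isLem587Prime (P : NFPoint) {d : ℕ} (hdeg : P.degree ≤ d) {ξ : ℝ} (hξ : IsXiPrm ξ)
    (hξQ : ξ ≤ Real.sqrt (logQForall P)) : ∃ ℓ : ℕ, IsLem587Prime d P ℓ :=
  exists_prime_P1_P2_P3_point P hdeg hξ hξQ

/-- A prime of Lemma 5.8.7 for a curve with `Q > 49` is `≥ 7` (indeed `ℓ ≥ Q^{1/2} > 7`). [folklore] -/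
private theorem seven_le_of_isLem587Prime {d : ℕ} {P : NFPoint} {ℓ : ℕ} (h : IsLem587Prime d P ℓ)
    (h49 : 49 < logQForall P) : 7 ≤ ℓ := by
  have h7s : (7 : ℝ) < Real.sqrt (logQForall P) := by
    rw [Real.lt_sqrt (by norm_num)]; linarith
  have : (7 : ℝ) < ℓ := lt_of_lt_of_le h7s h.2.1
  exact_mod_cast this.le

/-- **The finiteness behind every «enlarge Exc» step** (p.54 l.23–26 «by Proposition 5.6.1 … the height of C_λ is
bounded and by [Silverman, 1986, Theorem 2.1], there are only finitely many points in U(Q̄)_{≤d} of bounded degree and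
bounded height»): on `Z ∩ U(Q̄)_{≤d}` the curves with `Tate(C_λ) ≤ B` are finitely many — Northcott ([GenEll] Prop. 1.4
(iv), tree `northcott_UPle_holds`) through «(1/6)·Tate ≈ h» (Prop. 5.6.1 = [IUTchIV] Cor. 2.2 (i), tree
`Cor22.partI_holds`). PROVED. [claim: Joshi2024ATS4, status: disputed] -/
theorem hasFinitelyManyPoints_tate_le (D : CBData) (hD : Hypotheses D) (d : ℕ) (B : ℝ) :
    HasFinitelyManyPoints {P | P ∈ D.toSet ∩ UPle d ∧ logQForall P ≤ B} := by
  obtain ⟨_, h23, h3⟩ := partI_holds D hD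
  obtain ⟨C₀, hC₀⟩ := (h3.symm.trans h23.symm).bdLe
  refine (northcott_UPle_holds d (1 / 6 * B + C₀)).mono ?_
  rintro P ⟨⟨hPD, hPd⟩, hPB⟩
  refine ⟨hPd, ?_⟩
  have hx : NFPoint.ht P - 1 / 6 * logQForall P ≤ C₀ := hC₀ P hPD
  linarith

/-- **«there are finitely many elliptic curves for which Q^{1/2} ≤ ξ_prm»** (p.54 l.23; the second enlargement of `Exc`,
p.54 l.26). PROVED. [claim: Joshi2024ATS4, status: disputed] -/
theorem hasFinitelyManyPoints_sqrt_tate_le (D : CBData) (hD : Hypotheses D) (d : ℕ) (ξ : ℝ) :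
    HasFinitelyManyPoints {P | P ∈ D.toSet ∩ UPle d ∧ Real.sqrt (logQForall P) ≤ ξ} := by
  refine (hasFinitelyManyPoints_tate_le D hD d (ξ ^ 2)).mono ?_
  rintro P ⟨hP, hs⟩
  refine ⟨hP, ?_⟩
  have h0 : 0 ≤ logQForall P := logQAvoid_nonneg P ∅
  have hξ0 : 0 ≤ ξ := le_trans (Real.sqrt_nonneg _) hs
  nlinarith [Real.sq_sqrt h0, Real.sqrt_nonneg (logQForall P)]

/-- **«C_λ with a subgroup of C_λ[ℓ](L) of order ℓ»** (Lem. 5.8.8, p.56 l.45), OUR READING: over the field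
`L = L_mod(√−1, C_λ[2·3·5])` of Thm. 5.7.1 (a theta-field, `Cor22.IsThetaField`) the curve `C_λ/L` admits an `ℓ`-cyclic
subgroup scheme in the sense of [GenEll] Lem. 3.5 — the result Joshi cites as the proof — i.e. a `Gal(L̄/L)`-stable
subgroup of order `ℓ` of `C_λ[ℓ](L̄)` (`GenEll.EllPoint.AdmitsLCyclic`); an `L`-rational subgroup of order `ℓ` is the special
case with trivial action. [claim: Joshi2024ATS4, status: disputed] -/
def HasOrderLSubgroup (P : NFPoint) (ℓ : ℕ) : Prop :=
  ∃ (hU : P.InU) (L : Type) (_ : Field L) (_ : NumberField L) (_ : Algebra P.F L),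
    IsThetaField P L ∧ (thetaEllPoint P hU L).AdmitsLCyclic ℓ

/-- **[J-IV] Lemma 5.8.8** (p.56 l.43–45): «Let Z ⊂ U(Q̄)_{≤d}. Let ℓ be a prime given by Lemma 5.8.7. Then there are only
finitely many elliptic curves C_λ ∈ Z with a subgroup of C_λ[ℓ](L) of order ℓ.» («immediate from [Mochizuki, 2010, Lemma
3.5]», p.56 l.46; = [IUTchIV] p.45 (P4).) [claim: Joshi2024ATS4, status: disputed] -/
@[claim "Joshi2024ATS4" "disputed"]
def Lem588 (D : CBData) (d : ℕ) : Prop :=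
  HasFinitelyManyPoints {P | P ∈ D.toSet ∩ UPle d ∧ ∃ ℓ : ℕ, IsLem587Prime d P ℓ ∧ HasOrderLSubgroup P ℓ}

/-- **Lemma 5.8.8 HOLDS** on every `Z` as in Thm. 5.7.1: such curves have `Tate(C_λ) ≤ max(H_K, 49)` — for `Q > 49` the
prime of Lem. 5.8.7 is `≥ 7` and the tree's quantitative (P4) `Cor22.exists_logQForall_le_of_admitsLCyclic` ([GenEll] Lem.
3.5 + Prop. 3.4) bounds `Q` — whence finiteness (`hasFinitelyManyPoints_tate_le`). DISCHARGED.
[claim: Joshi2024ATS4, status: disputed] -/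
theorem lem588_holds (D : CBData) (hD : Hypotheses D) (d : ℕ) : Lem588 D d := by
  obtain ⟨HK, hHK⟩ := exists_logQForall_le_of_admitsLCyclic D
  refine (hasFinitelyManyPoints_tate_le D hD d (max HK 49)).mono ?_
  rintro P ⟨⟨hPD, hPd⟩, ℓ, hℓ, hU, L, _, _, _, hL, hcyc⟩
  refine ⟨⟨hPD, hPd⟩, ?_⟩
  by_contra hgt
  rw [not_le] at hgt
  have h49 : (49 : ℝ) < logQForall P := lt_of_le_of_lt (le_max_right _ _) hgt
  have h7 : 7 ≤ ℓ := seven_le_of_isLem587Prime hℓ h49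
  haveI : Fact ℓ.Prime := ⟨hℓ.1⟩
  letI iA : Algebra P.F (thetaEllPoint P hU L).F := ‹Algebra P.F L›
  haveI iG : IsGalois P.F (thetaEllPoint P hU L).F := hL.isGalois
  have hle := hHK P hPD (thetaEllPoint P hU L) hL.finrank_dvd (thetaCurve_j L hU) hL.isSemistable ℓ hℓ.1 h7
    hℓ.2.2.2.1 hcyc
  linarith [le_max_left HK 49]

/-- **[J-IV] Lemma 5.8.9 AS PRINTED** (p.56 l.48–50): «Suppose C_λ ∈ Z ∩ U(Q̄)_{≤d} (with Z satisfying (5.6.2)) is an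
elliptic curve such that no prime outside {v ∈ V_{L_mod} : v ∤ (2ℓ)} is a prime of multiplicative reduction of C_λ
[i.e. every prime of (potentially) multiplicative reduction is prime to 2ℓ], then C_λ is of bounded height» («bounded
height» = `Q` bounded, as in the proof p.57 l.5 «Q^{1/2} is bounded and hence Q is bounded»; `ℓ` a prime of Lem. 5.8.7,
p.57 l.3). (D3): typed, NOT proved, no claim made about its truth. [claim: Joshi2024ATS4, status: disputed] -/
@[claim "Joshi2024ATS4" "disputed"]
def Lem589AsPrinted (D : CBData) (d : ℕ) : Prop :=
  ∃ B : ℝ, ∀ P ∈ D.toSet ∩ UPle d, ∀ ℓ : ℕ, IsLem587Prime d P ℓ →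
    (∀ v ∈ badPlaces P, ((2 : ℕ) : 𝓞 P.F) ∉ v.asIdeal ∧ ((ℓ : ℕ) : 𝓞 P.F) ∉ v.asIdeal) → logQForall P ≤ B

/-- **[J-IV] Lemma 5.8.9, OUR READING** (= [IUTchIV] p.46, the (P5)-exclusion «if 𝕍^bad_mod = ∅ then h ≈ log(q^{∤2}) ≤
h^{1/2}·log(l) … h is bounded»; Joshi's proof p.57 l.1–6 is this argument): if EVERY prime of multiplicative reduction of
`C_λ` divides `2ℓ` (`¬ Cor22.CondP5 P ℓ`), `ℓ` a prime of Lem. 5.8.7, then `Q = Tate(C_λ)` is bounded on `Z ∩ U(Q̄)_{≤d}`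
by a constant depending only on `Z`, `d`. [claim: Joshi2024ATS4, status: disputed] -/
def Lem589 (D : CBData) (d : ℕ) : Prop :=
  ∃ B : ℝ, ∀ P ∈ D.toSet ∩ UPle d, ∀ ℓ : ℕ, IsLem587Prime d P ℓ → ¬ CondP5 P ℓ → logQForall P ≤ B

/-- **Display (5.8.10)** (p.57 l.2 «Q = Tate(C_λ) ≈ Tate_2(C_λ) ≤ Q^{1/2}·log(ℓ)»), typed as the two facts it rests on:
`Tate_2 − Tate_{∤2ℓ} ≤ Q^{1/2}·log ℓ` by (3) of Lem. 5.8.7 ([IUTchIV] p.47), and `Tate_{∤2ℓ} = 0` when no multiplicative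
prime lies outside `2ℓ`. PROVED (tree `logQAvoid_sub_insert_le`, `logQAvoid_pair_eq_zero_of_not_condP5`).
[claim: Joshi2024ATS4, status: disputed] -/
theorem ineq5810_holds {d : ℕ} {P : NFPoint} {ℓ : ℕ} (hℓ : IsLem587Prime d P ℓ) (hno : ¬ CondP5 P ℓ) :
    logQNotTwo P - logQAvoid P {2, ℓ} ≤ Real.sqrt (logQForall P) * Real.log ℓ ∧ logQAvoid P {2, ℓ} = 0 := by
  haveI : Fact ℓ.Prime := ⟨hℓ.1⟩
  refine ⟨?_, logQAvoid_pair_eq_zero_of_not_condP5 hno⟩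
  have := logQAvoid_sub_insert_le P {2} hℓ.1 (Real.sqrt_nonneg (logQForall P)) (fun v hv hlv =>
    (hℓ.2.2.2.2 v hv ((mem_placesOver_iff_residueChar v).mp (mem_placesOver_of_natCast_mem ℓ v hlv))).le)
  rwa [Finset.pair_comm] at this

/-- **Lemma 5.8.9 (OUR READING `Lem589`) HOLDS**, with `B = max(1, 2^20·δ + 24·B_Z)`, `B_Z` the constant of «Tate ≈
Tate_2» on `Z` (Prop. 5.6.1; tree `Cor22.partI_holds`): (5.8.10) gives `Q ≤ 6·B_Z + Q^{1/2}·log ℓ` with `ℓ ≤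
10δ·Q^{1/2}·log(2δ·Q)`, whence `Q` is bounded (tree `Cor22.h_le_of_le_add_sqrt_mul_log`, p.46). DISCHARGED.
[claim: Joshi2024ATS4, status: disputed] -/
theorem lem589_holds (D : CBData) (hD : Hypotheses D) {d : ℕ} (hd : 1 ≤ d) : Lem589 D d := by
  obtain ⟨h12, _, _⟩ := partI_holds D hD
  obtain ⟨B₀, hB₀⟩ := bdEquiv_iff_abs.mp h12
  set B₁ : ℝ := max B₀ 0 with hB₁
  have hB₁0 : 0 ≤ B₁ := le_max_right _ _
  refine ⟨max 1 (2 ^ 20 * delta d + 4 * (6 * B₁)), ?_⟩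
  rintro P ⟨hPD, hPd⟩ ℓ hℓ hno
  rcases lt_or_ge (logQForall P) 1 with hlt | hge
  · exact le_trans hlt.le (le_max_left _ _)
  refine le_trans ?_ (le_max_right _ _)
  obtain ⟨hQ1, hq0⟩ := ineq5810_holds hℓ hno
  have hx : |1 / 6 * logQNotTwo P - 1 / 6 * logQForall P| ≤ B₀ := hB₀ P hPD
  have hQ2 : logQForall P - logQNotTwo P ≤ 6 * B₁ := by
    have h1 := (abs_le.mp hx).1
    have h2 : B₀ ≤ B₁ := le_max_left _ _
    linarith
  have hδ : 2 ≤ delta d := by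
    have : (1 : ℝ) ≤ d := by exact_mod_cast hd
    unfold delta; nlinarith
  have hl0 : (0 : ℝ) < ℓ := by exact_mod_cast hℓ.1.pos
  exact h_le_of_le_add_sqrt_mul_log hge hδ (by positivity) hl0 hℓ.2.2.1 (by linarith)

/-- **[J-IV] Lemma 5.8.11** (p.57 l.9–14): «Let C_λ ∈ Z ⊂ U(Q̄)_{≤d} and C_λ ∉ Exc be an elliptic curve (so C_λ has [at]
least one prime of multiplicative reduction not lying over 2·ℓ). Let ρ_ℓ : G_L → GL_2(F_ℓ) be the Galois representation
on ℓ-torsion of C_λ. Then ρ_ℓ(G_L) ⊃ SL_2(F_ℓ).» Typed: outside a finite `Exc ⊆ Z ∩ U(Q̄)_{≤d}`, for every prime `ℓ` of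
Lem. 5.8.7 with a multiplicative prime not over `2ℓ` (`Cor22.CondP5`), the image of `Gal(L̄/L)` on `C_λ[ℓ]` contains
`SL_2(𝔽_ℓ)` for every theta-field `L` (`Cor22.CondP6`, via `GenEll.EllPoint.ImageModLContainsSL2`). («immediate from Lemma
5.8.9 and standard results … [Mochizuki, 2010, Theorem 3.8(b)]», p.57 l.15–16; = [IUTchIV] p.45–46 (P4)+(P5) ⟹ (P6).)
[claim: Joshi2024ATS4, status: disputed] -/
@[claim "Joshi2024ATS4" "disputed"]
def Lem5811 (D : CBData) (d : ℕ) : Prop :=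
  ∃ Exc : Set NFPoint, HasFinitelyManyPoints Exc ∧
    ∀ P ∈ D.toSet ∩ UPle d, P ∉ Exc → ∀ ℓ : ℕ, IsLem587Prime d P ℓ → CondP5 P ℓ → CondP6 P ℓ

/-- **Lemma 5.8.11 HOLDS** with `Exc = {C_λ ∈ Z ∩ U(Q̄)_{≤d} : Tate(C_λ) ≤ max(H_K, 49)}` (finite; contains the Lem. 5.8.8
exceptions and forces `ℓ ≥ Q^{1/2} > 7`), by the tree's (P4) ⟹ (P6) `Cor22.condP6_of_seven_le` ([GenEll] Lem. 3.5, Lem.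
3.1 (iii), Tate curve; = `Cor22.fullGaloisImage_holds`). DISCHARGED. [claim: Joshi2024ATS4, status: disputed] -/
theorem lem5811_holds (D : CBData) (hD : Hypotheses D) (d : ℕ) : Lem5811 D d := by
  obtain ⟨HK, hHK⟩ := condP6_of_seven_le D
  refine ⟨{P | P ∈ D.toSet ∩ UPle d ∧ logQForall P ≤ max HK 49}, hasFinitelyManyPoints_tate_le D hD d _, ?_⟩
  rintro P ⟨hPD, hPd⟩ hPexc ℓ hℓ hP5
  have hgt : max HK 49 < logQForall P := by
    by_contra hle
    exact hPexc ⟨⟨hPD, hPd⟩, not_lt.mp hle⟩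
  have h49 : (49 : ℝ) < logQForall P := lt_of_le_of_lt (le_max_right _ _) hgt
  exact hHK P hPD hPd.1 ℓ hℓ.1 (seven_le_of_isLem587Prime hℓ h49) hℓ.2.2.2.1 hP5
    (lt_of_le_of_lt (le_max_left _ _) hgt)

/-- The union of two sets with finitely many points has finitely many points. [folklore] -/
private theorem hasFinitelyManyPoints_union {S T : Set NFPoint} (hS : HasFinitelyManyPoints S)
    (hT : HasFinitelyManyPoints T) : HasFinitelyManyPoints (S ∪ T) := by
  unfold HasFinitelyManyPoints at *
  rw [Set.image_union]
  exact hS.union hT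

/-- **«Completion of the Proof of Theorem 5.7.1»** (p.57 l.17–26) up to the Θ-data clause: «The existence of the prime
number ℓ … is given by Lemma 5.8.7. … Choose any curve C_λ in Z not in Exc … by Lemma 5.8.9, C_λ has at least one prime of
multiplicative reduction [not over 2ℓ] … By Lemma 5.8.8 and Lemma 5.8.11 … ρ_ℓ … has full image.» PROVED: outside ONE
finite `Exc = Exc(Z, d)` every curve of `Z ∩ U(Q̄)_{≤d}` carries a prime `ℓ ≥ 7` of Lem. 5.8.7 with a multiplicative prime
not over `2ℓ` and `SL_2(𝔽_ℓ) ⊆ ρ_ℓ(G_L)` — the tree's (P1)–(P6) package of [IUTchIV] pp. 44–46. The remaining clause «C_λ is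
equipped with an Initial Theta Data [J-III §3.1, §3.3; §2.4]» (p.57 l.23–26) is Thm. 5.7.1's conclusion (slot T-28;
[IUTchI] Def. 3.1, `TODO(L5)` in the tree's `Cor22.PartII`) and is NOT typed here. [claim: Joshi2024ATS4, status: disputed] -/
theorem completion_P1_to_P6 (D : CBData) (hD : Hypotheses D) {d : ℕ} (hd : 1 ≤ d) :
    ∃ Exc : Set NFPoint, HasFinitelyManyPoints Exc ∧
      ∀ P ∈ D.toSet ∩ UPle d, P ∉ Exc →
        ∃ ℓ : ℕ, IsLem587Prime d P ℓ ∧ 7 ≤ ℓ ∧ CondP5 P ℓ ∧ CondP6 P ℓ := by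
  obtain ⟨ξ, hξ⟩ := exists_isXiPrm
  obtain ⟨B, hB⟩ := lem589_holds D hD hd
  obtain ⟨Exc₁, hExc₁, h11⟩ := lem5811_holds D hD d
  set Bd : ℝ := max (max B 49) (ξ ^ 2) with hBd
  refine ⟨Exc₁ ∪ {P | P ∈ D.toSet ∩ UPle d ∧ logQForall P ≤ Bd},
    hasFinitelyManyPoints_union hExc₁ (hasFinitelyManyPoints_tate_le D hD d Bd), ?_⟩
  rintro P ⟨hPD, hPd⟩ hP
  have hP1 : P ∉ Exc₁ := fun h => hP (Or.inl h)
  have hgt : Bd < logQForall P := by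
    by_contra hle
    exact hP (Or.inr ⟨⟨hPD, hPd⟩, not_lt.mp hle⟩)
  have h49 : (49 : ℝ) < logQForall P := lt_of_le_of_lt (le_trans (le_max_right _ _) (le_max_left _ _)) hgt
  have hBlt : B < logQForall P := lt_of_le_of_lt (le_trans (le_max_left _ _) (le_max_left _ _)) hgt
  have hξQ : ξ ≤ Real.sqrt (logQForall P) := by
    have hlt : ξ ^ 2 < logQForall P := lt_of_le_of_lt (le_max_right _ _) hgt
    have hξ0 : 0 ≤ ξ := le_trans (by norm_num) hξ.1
    rw [show ξ = Real.sqrt (ξ ^ 2) from (Real.sqrt_sq hξ0).symm]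
    exact Real.sqrt_le_sqrt hlt.le
  obtain ⟨ℓ, hℓ⟩ := exists_isLem587Prime P hPd.2 hξ hξQ
  have hP5 : CondP5 P ℓ := by
    by_contra hno
    have := hB P ⟨hPD, hPd⟩ ℓ hℓ hno
    linarith
  exact ⟨ℓ, hℓ, seven_le_of_isLem587Prime hℓ h49, hP5, h11 P ⟨hPD, hPd⟩ hP1 ℓ hℓ hP5⟩

/-! ## Appendix: which §5.8 lemmas use (5.6.2) — the division of hypotheses, kernel-checked

Joshi writes «(with Z satisfying (5.6.2))» in Lemma 5.8.9 only (p.56 l.49). Indeed: the finiteness steps, Lemma 5.8.8 and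
Lemma 5.8.11 hold on EVERY compactly bounded `Z ⊂ U(Q̄)_{≤d}` — they use of Prop. 5.6.1 only the equivalences
«(1/6)·Tate ≈ (1/6)·h_∞ ≈ h_{ω_{ℙ¹}(D)}» (= [IUTchIV] Cor. 2.2 (i) middle/third, tree `Cor22.partI_middle` / `partI_third`,
hypothesis-free: only the archimedean bounding domain enters), whereas Lemma 5.8.9 uses «Tate ≈ Tate₂» (Cor. 2.2 (i) first
equivalence, `Cor22.partI_first`, which needs `2 ∈ S` and (5.6.2) = `Cor22.Hypotheses`). The primed theorems below drop the
unused hypothesis `Cor22.Hypotheses D` from `hasFinitelyManyPoints_tate_le`, `lem588_holds`, `lem5811_holds`. -/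

/-- The finiteness behind the «enlarge Exc» steps holds on EVERY compactly bounded `Z` (no (5.6.2), no «2 ∈ S»): Northcott
through `(1/6)·Tate ≈ h` (`Cor22.partI_middle`, `Cor22.partI_third`). PROVED. [claim: Joshi2024ATS4, status: disputed] -/
theorem hasFinitelyManyPoints_tate_le' (D : CBData) (d : ℕ) (B : ℝ) :
    HasFinitelyManyPoints {P | P ∈ D.toSet ∩ UPle d ∧ logQForall P ≤ B} := by
  obtain ⟨C₀, hC₀⟩ := ((partI_third D).symm.trans (partI_middle D).symm).bdLe
  refine (northcott_UPle_holds d (1 / 6 * B + C₀)).mono ?_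
  rintro P ⟨⟨hPD, hPd⟩, hPB⟩
  refine ⟨hPd, ?_⟩
  have hx : NFPoint.ht P - 1 / 6 * logQForall P ≤ C₀ := hC₀ P hPD
  linarith

/-- **Lemma 5.8.8 HOLDS on every compactly bounded `Z ⊂ U(Q̄)_{≤d}`** (p.56 l.43 «Let Z ⊂ U(Q̄)_{≤d}» — no (5.6.2) needed,
as printed). PROVED. [claim: Joshi2024ATS4, status: disputed] -/
theorem lem588_holds' (D : CBData) (d : ℕ) : Lem588 D d := by
  obtain ⟨HK, hHK⟩ := exists_logQForall_le_of_admitsLCyclic D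
  refine (hasFinitelyManyPoints_tate_le' D d (max HK 49)).mono ?_
  rintro P ⟨⟨hPD, hPd⟩, ℓ, hℓ, hU, L, _, _, _, hL, hcyc⟩
  refine ⟨⟨hPD, hPd⟩, ?_⟩
  by_contra hgt
  rw [not_le] at hgt
  have h49 : (49 : ℝ) < logQForall P := lt_of_le_of_lt (le_max_right _ _) hgt
  have h7 : 7 ≤ ℓ := seven_le_of_isLem587Prime hℓ h49
  haveI : Fact ℓ.Prime := ⟨hℓ.1⟩
  letI iA : Algebra P.F (thetaEllPoint P hU L).F := ‹Algebra P.F L›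
  haveI iG : IsGalois P.F (thetaEllPoint P hU L).F := hL.isGalois
  have hle := hHK P hPD (thetaEllPoint P hU L) hL.finrank_dvd (thetaCurve_j L hU) hL.isSemistable ℓ hℓ.1 h7
    hℓ.2.2.2.1 hcyc
  linarith [le_max_left HK 49]

/-- **Lemma 5.8.11 HOLDS on every compactly bounded `Z ⊂ U(Q̄)_{≤d}`** (p.57 l.9–10 «Let C_λ ∈ Z ⊂ U(Q̄)_{≤d} and C_λ ∉
Exc» — no (5.6.2) needed). PROVED. [claim: Joshi2024ATS4, status: disputed] -/
theorem lem5811_holds' (D : CBData) (d : ℕ) : Lem5811 D d := by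
  obtain ⟨HK, hHK⟩ := condP6_of_seven_le D
  refine ⟨{P | P ∈ D.toSet ∩ UPle d ∧ logQForall P ≤ max HK 49}, hasFinitelyManyPoints_tate_le' D d _, ?_⟩
  rintro P ⟨hPD, hPd⟩ hPexc ℓ hℓ hP5
  have hgt : max HK 49 < logQForall P := by
    by_contra hle
    exact hPexc ⟨⟨hPD, hPd⟩, not_lt.mp hle⟩
  have h49 : (49 : ℝ) < logQForall P := lt_of_le_of_lt (le_max_right _ _) hgt
  exact hHK P hPD hPd.1 ℓ hℓ.1 (seven_le_of_isLem587Prime hℓ h49) hℓ.2.2.2.1 hP5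
    (lt_of_le_of_lt (le_max_left _ _) hgt)

end Summit.ABC.IUTFork.Joshi.ATS4

end
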